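import Summits.Ventures.PercRepro.RankLevelSetExplicitMultArithB
import Summits.Ventures.PercRepro.RankLevelSetExplicitCap
import Summits.Ventures.PercRepro.RankLevelSetDepCountMult
import Summits.Ventures.PercRepro.S1TriangleCount
import Summits.Ventures.PercRepro.S1FourCircuitCount
import Summits.Ventures.PercRepro.RankLevelSetPlaneSix
import Summits.Ventures.PercRepro.RankLevelSetCoreSparse
import Summits.Ventures.PercRepro.RankLevelSetLocalSparse

/-!
# PercRepro — THEOREM P⁗: C-025 AT EVERY LEVEL `q ≥ 3` FOR EVERY `p ≥ Pmult q`, WITH THE THRESHOLD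
`Pmult q ≤ Tmult q + 1 = q·2^{⌈5q/4⌉+2} + 5q·2^{q+2} + 1` (p9, S4)

`proofs/SUBCLAIM-S4-p9.md` §S4.2‴. THEOREM P‴ (`RankLevelSetExplicitCap`, `Pcap q ≤ (q+2)·2^{2q+6} + 1`) counts the
`U`-side with night-1's SPLIT count and the nullity cap; its exponent `2q` comes from the `k = 3` circuit term at the
top corank. Here the same induction runs on night-1's MULTIPLICITY count (`ncard_eRk_eq_ncard_eq_mul_le`: a dependent
rank-`q` set of `m` elements is reached from `≥ m − q` pairs `(C, B′)`, so the level-`m` count carries the factor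
`m − q`; `ncard_eRk_eq_ncard_le_le_sum` adds the sizes), with
* the weights in closed form, `W = Σ_{j < d−q} C(F, j)/(j+1) ≤ (2^{F+1} − 1)/(F+1)`;
* LOCAL SPARSITY for the small-class weight index, `F′ + 1 = min (2^{q−1} − q) d` (rank-`≤ q−1` sets of the
  `e`-free core have `≤ 2^{q−1} − 1` points), the cap for the big class, `F + 1 = d`;
* Lemma T (`2s₃ ≤ d(d+1)`, S1TriangleCount) and Lemma T4 (`3s₄ ≤ d(d+1)(d+2)`, S1FourCircuitCount) for the two leading
  circuit counts, `s_k ≤ C(d+k−1, k)` and Vandermonde after factoring `5` for the rest;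
and the polynomial inequality `poly_main_mult` (`RankLevelSetExplicitMultArithB`) at every corank
`q + 1 ≤ d ≤ q + 2^q` for `p ≥ Tmult q`. Coranks `≥ q + 2^q + 1` are `c025_core_explicit_large'`, coranks `≤ q` are
`U = ∅` / Theorem M, the wrapper is `rls_succ_large` — THEOREM P's induction verbatim with `Tmult` for `Tcore`:

* `c025_mult_all (q) (hq : 3 ≤ q) : ∀ M [M.Finite] p, Pmult q ≤ p → RLS M p q`, `Pmult 3 = 5`,
  `Pmult (q+1) = max (Pmult q) (Tmult (q+1)) + 1`, and the closed form `Pmult_le_Tmult_succ : Pmult q ≤ Tmult q + 1`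
  (`q ≥ 4`): `Tmult 4 = 1 792`, `Tmult 5 = 5 760`, `Tmult 6 = 13 824`, `Tmult 7 = 32 256`, `Tmult 8 = 73 728`,
  `Tmult 9 = 239 616`, `Tmult 10 = 532 480`, `Tmult 20 ≈ 3.1·10^9` — against `Tcap 7 = 9 437 184`,
  `Tcap 8 = 41 943 040`, `Tcap 20 ≈ 1.5·10^15` (and the per-corank ladders `650` / `1 588` at `q = 7` / `8`).
Every fact used is a kernel theorem of the cell's tree or Mathlib. Axioms: standard.
-/

open scoped Matroid

namespace PercRepro

namespace ThmN

open Set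

variable {α : Type}

/-- **The `e`-free core at level `q ≥ 4`, bounded corank `q + 1 ≤ d ≤ q + 2^q`, rank `p ≥ Tmult q`** — the
multiplicity count with the cap and local sparsity, Lemma T, Lemma T4, Vandermonde after factoring `5`, the tail
`16·Σ_{j ≤ 2q+2^q} C(n, j) ≤ 2^n`, and `poly_main_mult`. -/
theorem c025_core_mult_bounded (q : ℕ) (hq : 4 ≤ q) (M : Matroid α) [M.Finite] (p d : ℕ)
    (hp : Explicit.Tmult q ≤ p) (hd1 : q + 1 ≤ d) (hd2 : d ≤ q + 2 ^ q)
    (hR : M.eRank = (p : ℕ∞)) (hn : M.E.ncard = p + d)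
    (hfree : ∀ e ∈ M.E, ∃ A ⊆ M.E \ {e}, e ∉ M.closure A ∧ e ∉ M.closure ((M.E \ {e}) \ A)) :
    RLS M p q := by
  classical
  obtain ⟨-, -, htail, -, -, -⟩ := Explicit.Tmult_bounds q hq
  obtain ⟨hy, -, hqy, -⟩ := Explicit.two_pow_facts q hq
  have hEcard : M.ground_finite.toFinset.card = p + d := by
    rw [← Set.ncard_eq_toFinset_card _ M.ground_finite]; exact hn
  -- the core is simple: every circuit has `≥ 3` elements
  have hL : ∀ e ∈ M.E, ¬ M.IsLoop e := not_isLoop_of_free M hfree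
  have hs : ∀ e ∈ M.E, ∀ f ∈ M.E, e ≠ f → M.eRk {e, f} = 2 := by
    intro e he f hf hef
    have h2 : (2 : ℕ∞) ≤ M.eRk {e, f} :=
      two_le_eRk_of_two_le_ncard_of_free M hfree (pair_subset he hf) (by rw [ncard_pair hef])
    have h3 : M.eRk {e, f} ≤ 2 := by
      have := M.eRk_le_encard {e, f}
      rwa [encard_pair hef] at this
    exact le_antisymm h3 h2
  have hcirc : ∀ C, M.IsCircuit C → 3 ≤ C.encard := three_le_encard_of_circuit M hL hs
  have hd : M.E.encard = M.eRank + d := by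
    rw [hR, ← M.ground_finite.cast_ncard_eq, hn]
    push_cast
    ring
  -- the nullity cap: every `X ⊆ E` has `|X| ≤ r(X) + d`
  have hcap : ∀ X ⊆ M.E, ∀ k : ℕ, M.eRk X ≤ k → X.ncard ≤ k + d := by
    intro X hX k hr
    have h1 := Matroid.encard_le_eRk_add_of_encard_eq hX hd
    have h2 : X.encard ≤ (k : ℕ∞) + d := h1.trans (by gcongr)
    have hfin : X.Finite := M.ground_finite.subset hX
    rw [← hfin.cast_ncard_eq] at h2
    exact_mod_cast h2
  -- rank-`≤ q` sets have `≤ q + d` points (the cap); rank-`≤ q − 1` sets `≤ min (2^{q−1} − 1) (q − 1 + d)` points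
  set f' : ℕ := min (2 ^ (q - 1) - 1) (q - 1 + d) with hf'def
  have hflat : ∀ X ⊆ M.E, M.eRk X ≤ q → X.ncard ≤ q + d := fun X hX hr => hcap X hX q hr
  have hflat' : ∀ X ⊆ M.E, M.eRk X ≤ ((q - 1 : ℕ) : ℕ∞) → X.ncard ≤ f' := by
    intro X hX hr
    refine le_min ?_ (hcap X hX (q - 1) hr)
    have := ncard_add_one_le_two_pow_of_eRk_le M hL hfree (q - 1) X hX hr
    omega
  -- the weight index of the small class: `f' − q + 1 = μ := min (2^{q−1} − q) d`
  set μ : ℕ := min (2 ^ (q - 1) - q) d with hμdef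
  have hμ : f' - q + 1 = μ := by
    rw [hf'def, hμdef]
    rcases le_total (2 ^ (q - 1) - 1) (q - 1 + d) with h | h
    · rw [min_eq_left h, min_eq_left (by omega)]; omega
    · rw [min_eq_right h, min_eq_right (by omega)]; omega
  have hμd : μ ≤ d := min_le_right _ _
  -- (U): the multiplicity count
  have hU1 := Matroid.topCount_le_ncard_compl (M := M) hR hd q
  have hsum := Matroid.ncard_eRk_eq_ncard_le_le_sum (M := M) q d
  have hmul := fun m => Matroid.ncard_eRk_eq_ncard_eq_mul_le M q (q + d) f' (by omega) hcirc hflat hflat' hd m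
  -- the circuit counts: Lemma T, Lemma T4, `s_k ≤ C(d+k−1, k)`
  have hC1 : ∀ L ⊆ M.E, M.eRk L = 2 → L.ncard ≤ 3 :=
    fun L hL' hr => ncard_le_three_of_eRk_two M hs hfree hL' hr
  have hs3 : 2 * {C | M.IsCircuit C ∧ C.ncard = 3}.ncard ≤ d * (d + 1) := S1.two_mul_ncard_triangles_le M hC1 hd
  have hC1' : ∀ L ⊆ M.E, M.eRk L ≤ 2 → L.ncard ≤ 3 := by
    intro L hL' hr
    have := ncard_add_one_le_two_pow_of_eRk_le M hL hfree 2 L hL' hr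
    omega
  have hC2 : ∀ P ⊆ M.E, M.eRk P ≤ 3 → P.ncard ≤ 6 :=
    fun P hP hr => ncard_le_six_of_eRk_le_three_of_free M hfree hP hr
  have hs4 : 3 * {C : Set α | M.IsCircuit C ∧ C.ncard = 4}.ncard ≤ d * (d + 1) * (d + 2) :=
    S1.three_mul_ncard_four_circuits_le M hC1' hC2 hd
  have hcs : ∀ k, 3 ≤ k → {C | M.IsCircuit C ∧ C.ncard = k}.ncard ≤ (d + k - 1).choose k := by
    intro k hk
    have := Matroid.ncard_circuits_le_choose_of_encard M hd (k - 1)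
    rw [show k - 1 + 1 = k by omega, show d + (k - 1) = d + k - 1 by omega] at this
    exact this
  -- the two pair sums, bounded
  set A : ℕ := ∑ k ∈ Finset.Icc 3 (q + 1), {C | M.IsCircuit C ∧ C.ncard = k}.ncard * M.E.ncard.choose (q + 1 - k)
    with hAdef
  set B : ℕ := ∑ k ∈ Finset.Icc 3 (q + 1), {C | M.IsCircuit C ∧ C.ncard = k}.ncard * ((q + 1) * d).choose (q + 1 - k)
    with hBdef
  have hA : 6 * A ≤ 3 * (d * (d + 1)) * (p + d).choose (q - 2) + 2 * (d * (d + 1) * (d + 2)) * (p + d).choose (q - 3) +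
      6 * ((d + q).choose 5 * (d + q - 5 + (p + d)).choose (q - 4)) := by
    rw [hAdef, hn, Explicit.sum_Icc_three_split q hq, show q + 1 - 3 = q - 2 by omega, show q + 1 - 4 = q - 3 by omega]
    have h5 : ∑ k ∈ Finset.Icc 5 (q + 1), {C | M.IsCircuit C ∧ C.ncard = k}.ncard * (p + d).choose (q + 1 - k) ≤
        (d + q).choose 5 * (d + q - 5 + (p + d)).choose (q - 4) := by
      refine (Finset.sum_le_sum (fun k hk => Nat.mul_le_mul_right _ (hcs k (by rw [Finset.mem_Icc] at hk; omega)))).trans ?_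
      exact Explicit.circuit_sum_le_vandermonde_five q d (p + d) hq
    have e3 : 6 * ({C | M.IsCircuit C ∧ C.ncard = 3}.ncard * (p + d).choose (q - 2)) ≤
        3 * (d * (d + 1)) * (p + d).choose (q - 2) := by
      calc 6 * ({C | M.IsCircuit C ∧ C.ncard = 3}.ncard * (p + d).choose (q - 2))
          = 3 * ((2 * {C | M.IsCircuit C ∧ C.ncard = 3}.ncard) * (p + d).choose (q - 2)) := by ring
        _ ≤ 3 * ((d * (d + 1)) * (p + d).choose (q - 2)) := Nat.mul_le_mul_left _ (Nat.mul_le_mul_right _ hs3)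
        _ = 3 * (d * (d + 1)) * (p + d).choose (q - 2) := by ring
    have e4 : 6 * ({C | M.IsCircuit C ∧ C.ncard = 4}.ncard * (p + d).choose (q - 3)) ≤
        2 * (d * (d + 1) * (d + 2)) * (p + d).choose (q - 3) := by
      calc 6 * ({C | M.IsCircuit C ∧ C.ncard = 4}.ncard * (p + d).choose (q - 3))
          = 2 * ((3 * {C | M.IsCircuit C ∧ C.ncard = 4}.ncard) * (p + d).choose (q - 3)) := by ring
        _ ≤ 2 * ((d * (d + 1) * (d + 2)) * (p + d).choose (q - 3)) := Nat.mul_le_mul_left _ (Nat.mul_le_mul_right _ hs4)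
        _ = 2 * (d * (d + 1) * (d + 2)) * (p + d).choose (q - 3) := by ring
    have e5 := Nat.mul_le_mul_left 6 h5
    omega
  have hB : B ≤ (d + q).choose 3 * (d + q - 3 + (q + 1) * d).choose (q - 2) := by
    rw [hBdef]
    refine (Finset.sum_le_sum (fun k hk => Nat.mul_le_mul_right _ (hcs k (by rw [Finset.mem_Icc] at hk; omega)))).trans ?_
    exact Explicit.circuit_sum_le_vandermonde q d ((q + 1) * d) (by omega)
  -- the level counts in `ℚ`, weighted by `1/(m − q)`
  have hlevel : ∀ m ∈ Finset.Icc (q + 1) d, ({X : Set α | X ⊆ M.E ∧ M.eRk X = q ∧ X.ncard = m}.ncard : ℚ) ≤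
      (((f' - q).choose (m - (q + 1)) : ℚ) * (A : ℚ) + ((q + d - (q + 1)).choose (m - (q + 1)) : ℚ) * (B : ℚ)) /
        ((m - q : ℕ) : ℚ) := by
    intro m hm
    rw [Finset.mem_Icc] at hm
    have hpos : (0 : ℚ) < ((m - q : ℕ) : ℚ) := by exact_mod_cast (by omega : 0 < m - q)
    rw [le_div_iff₀ hpos]
    have h := hmul m
    have h' : (((m - q) * {X : Set α | X ⊆ M.E ∧ M.eRk X = q ∧ X.ncard = m}.ncard : ℕ) : ℚ) ≤
        (((f' - q).choose (m - (q + 1)) * A + (q + d - (q + 1)).choose (m - (q + 1)) * B : ℕ) : ℚ) := by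
      exact_mod_cast h
    push_cast at h'
    linarith
  have hre : ∑ m ∈ Finset.Icc (q + 1) d,
      (((f' - q).choose (m - (q + 1)) : ℚ) * (A : ℚ) + ((q + d - (q + 1)).choose (m - (q + 1)) : ℚ) * (B : ℚ)) /
        ((m - q : ℕ) : ℚ) =
      ∑ j ∈ Finset.range (d - q),
      (((f' - q).choose j : ℚ) * (A : ℚ) + ((d - 1).choose j : ℚ) * (B : ℚ)) / ((j : ℚ) + 1) := by
    rw [show Finset.Icc (q + 1) d = Finset.image (fun j => q + 1 + j) (Finset.range (d - q)) from ?_]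
    · rw [Finset.sum_image (fun a _ b _ h => by omega)]
      apply Finset.sum_congr rfl
      intro j _
      rw [show q + 1 + j - (q + 1) = j by omega, show q + 1 + j - q = j + 1 by omega,
        show q + d - (q + 1) = d - 1 by omega]
      push_cast
      ring
    · ext m
      rw [Finset.mem_Icc, Finset.mem_image]
      constructor
      · intro hm
        exact ⟨m - (q + 1), by rw [Finset.mem_range]; omega, by omega⟩
      · rintro ⟨j, hj, rfl⟩
        rw [Finset.mem_range] at hj
        omega
  -- the two weights
  set Ws : ℚ := ∑ j ∈ Finset.range (d - q), (((f' - q).choose j : ℕ) : ℚ) / ((j : ℚ) + 1) with hWsdef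
  set Wb : ℚ := ∑ j ∈ Finset.range (d - q), (((d - 1).choose j : ℕ) : ℚ) / ((j : ℚ) + 1) with hWbdef
  have hUq : (Matroid.topCount M p q : ℚ) ≤ ((p + d).choose q : ℚ) + (Ws * (A : ℚ) + Wb * (B : ℚ)) := by
    have h1 : (Matroid.topCount M p q : ℚ) ≤ ((p + d).choose q : ℚ) +
        ∑ m ∈ Finset.Icc (q + 1) d, ({X : Set α | X ⊆ M.E ∧ M.eRk X = q ∧ X.ncard = m}.ncard : ℚ) := by
      have := hU1.trans hsum
      rw [hn] at this
      exact_mod_cast this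
    have h2 : ∑ m ∈ Finset.Icc (q + 1) d, ({X : Set α | X ⊆ M.E ∧ M.eRk X = q ∧ X.ncard = m}.ncard : ℚ) ≤
        Ws * (A : ℚ) + Wb * (B : ℚ) := by
      rw [hWsdef, hWbdef, Finset.sum_mul, Finset.sum_mul, ← Finset.sum_add_distrib]
      refine (Finset.sum_le_sum hlevel).trans (hre.le.trans ?_)
      apply le_of_eq
      apply Finset.sum_congr rfl
      intro j _
      field_simp
    linarith
  -- the weight bounds: `Ws·μ ≤ 2^d`, `Wb·d ≤ 2^d`
  have hWs : Ws * (μ : ℚ) ≤ 2 ^ d := by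
    have h1 := Explicit.sum_range_choose_div_succ_le (f' - q) (d - q)
    rw [← hWsdef] at h1
    have hμq : ((f' - q : ℕ) : ℚ) + 1 = (μ : ℚ) := by exact_mod_cast hμ
    have hμpos : (0 : ℚ) < (μ : ℚ) := by
      have : 1 ≤ μ := by omega
      exact_mod_cast this
    rw [hμq, le_div_iff₀ hμpos] at h1
    have h2 : (2 : ℚ) ^ (f' - q + 1) ≤ 2 ^ d := pow_le_pow_right₀ (by norm_num) (by omega)
    linarith
  have hWb : Wb * (d : ℚ) ≤ 2 ^ d := by
    have h1 := Explicit.sum_range_choose_div_succ_le (d - 1) (d - q)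
    rw [← hWbdef, show d - 1 + 1 = d by omega] at h1
    have hdq : ((d - 1 : ℕ) : ℚ) + 1 = (d : ℚ) := by
      have : d - 1 + 1 = d := by omega
      exact_mod_cast this
    have hdpos : (0 : ℚ) < (d : ℚ) := by exact_mod_cast (show 0 < d by omega)
    rw [hdq, le_div_iff₀ hdpos] at h1
    linarith
  -- (Y)
  have hY := Matroid.two_pow_le_midCount_add (M := M) p q hR
  have hAc : {X : Set α | X ⊆ M.E ∧ M.eRk X ≤ q}.ncard ≤ ∑ j ∈ Finset.range (q + d + 1), (p + d).choose j := by
    calc {X : Set α | X ⊆ M.E ∧ M.eRk X ≤ q}.ncard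
        ≤ {X : Set α | X ⊆ (M.ground_finite.toFinset : Set α) ∧ X.ncard ≤ q + d}.ncard := by
          apply ncard_le_ncard
          · intro X hX
            exact ⟨by rw [Set.Finite.coe_toFinset]; exact hX.1, hflat X hX.1 hX.2⟩
          · exact (Finset.finite_toSet _).finite_subsets.subset (fun X hX => hX.1)
      _ ≤ ∑ j ∈ Finset.range (q + d + 1), M.ground_finite.toFinset.card.choose j :=
          ncard_subsets_ncard_le _ (q + d)
      _ = ∑ j ∈ Finset.range (q + d + 1), (p + d).choose j := by rw [hEcard]
  have hBc := Matroid.ncard_spanning_le (M := M) hd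
  rw [hEcard] at hY hBc
  -- the tail with `K = 2q + 2^q`
  have hT : 16 * ∑ j ∈ Finset.range (2 * q + 2 ^ q + 1), (p + d).choose j ≤ 2 ^ (p + d) :=
    Explicit.sixteen_mul_sum_range_choose_le (2 * q + 2 ^ q) (p + d) (by omega)
  have hA' : ∑ j ∈ Finset.range (q + d + 1), (p + d).choose j ≤
      ∑ j ∈ Finset.range (2 * q + 2 ^ q + 1), (p + d).choose j :=
    Finset.sum_le_sum_of_subset_of_nonneg (Finset.range_mono (by omega)) (fun _ _ _ => Nat.zero_le _)
  have hB' : ∑ j ∈ Finset.range (d + 1), (p + d).choose j ≤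
      ∑ j ∈ Finset.range (2 * q + 2 ^ q + 1), (p + d).choose j :=
    Finset.sum_le_sum_of_subset_of_nonneg (Finset.range_mono (by omega)) (fun _ _ _ => Nat.zero_le _)
  have hAB : 8 * ({X : Set α | X ⊆ M.E ∧ M.eRk X ≤ q}.ncard +
      {X : Set α | X ⊆ M.E ∧ M.eRk X = M.eRank}.ncard) ≤ 2 ^ (p + d) := by
    have h1 := hAc.trans hA'
    have h2 := hBc.trans hB'
    omega
  -- (Φ) and the polynomial inequality
  have hΦ := phiK_le_two_pow_div p q
  rw [Nat.choose_symm_add] at hΦ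
  have hpolyq := Explicit.poly_main_mult q d p μ hq hd1 hd2 hp rfl A B Ws Wb hWs hWb hA hB
  rw [add_assoc] at hpolyq
  -- assemble in `ℚ`
  rw [RLS_iff]
  have hYq : (2 : ℚ) ^ (p + d) ≤ (Matroid.midCount M p q : ℚ) +
      ({X : Set α | X ⊆ M.E ∧ M.eRk X ≤ q}.ncard : ℚ) +
      ({X : Set α | X ⊆ M.E ∧ M.eRk X = M.eRank}.ncard : ℚ) := by exact_mod_cast hY
  have hABq : 8 * (({X : Set α | X ⊆ M.E ∧ M.eRk X ≤ q}.ncard : ℚ) +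
      ({X : Set α | X ⊆ M.E ∧ M.eRk X = M.eRank}.ncard : ℚ)) ≤ 2 ^ (p + d) := by exact_mod_cast hAB
  have hU0 : (0 : ℚ) ≤ (Matroid.topCount M p q : ℚ) := Nat.cast_nonneg _
  exact level_arith (p := p) (d := d) (n := p + d) (q := q) rfl (by omega) hΦ hU0 hUq hYq hABq hpolyq

/-- **The level step with the multiplicity threshold**: level `q` for all `p ≥ P` and `P ≥ Tmult (q+1)` give
level `q + 1` for all `p ≥ P + 1` (`rls_succ_large` with `D = q + 1`; the core is `c025_core_mult_bounded` /
`c025_core_explicit_large'` at level `q + 1`). -/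
theorem c025_succ_mult (q : ℕ) (hq : 3 ≤ q) (P : ℕ) (hP : Explicit.Tmult (q + 1) ≤ P)
    (hprev : ∀ (M : Matroid α) [M.Finite] (p : ℕ), P ≤ p → q + 2 ≤ p → RLS M p q) :
    ∀ (M : Matroid α) [M.Finite] (p : ℕ), P + 1 ≤ p → RLS M p (q + 1) := by
  intro M _ p hp
  obtain ⟨hN₁, -, -, -, -, -⟩ := Explicit.Tmult_bounds (q + 1) (by omega)
  have hq3 : q + 3 ≤ Explicit.Tmult (q + 1) := by
    have := Explicit.succ_le_two_pow (q + 1)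
    have h := Explicit.Tmult_bounds (q + 1) (by omega)
    omega
  refine rls_succ_large (α := α) q (q + 1) P hprev ?_ ?_ M p hp (by omega)
  · -- corank `≤ q + 1`: `U = ∅` or Theorem M
    intro M' _ p' _ hn _
    rcases Nat.lt_or_ge M'.E.ncard (p' + (q + 1)) with h | h
    · exact RLS_of_ncard_lt M' h
    · exact RLS_of_ncard_eq M' (by omega)
  · -- the core at level `q + 1`
    intro M' _ p' hP' hR hbig _ hfree
    rcases Nat.lt_or_ge M'.E.ncard (p' + (q + 1) + 2 ^ (q + 1) + 1) with h | h
    · exact c025_core_mult_bounded (q + 1) (by omega) M' p' (M'.E.ncard - p') (hP.trans hP')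
        (by omega) (by omega) hR (by omega) hfree
    · exact c025_core_explicit_large' (q + 1) (by omega) M' p' (by omega) hR (by omega) hfree

/-- **THE MULTIPLICITY THRESHOLD SEQUENCE** `Pmult`: `Pmult 3 = 5` (the `q = 3` row), and
`Pmult (q+1) = max (Pmult q) (Tmult (q+1)) + 1` for `q ≥ 3`. -/
def Pmult : ℕ → ℕ
  | 0 => 5
  | 1 => 5
  | 2 => 5
  | 3 => 5
  | q + 4 => max (Pmult (q + 3)) (Explicit.Tmult (q + 4)) + 1

/-- The recursion of `Pmult` at `q ≥ 3`. -/
theorem Pmult_succ (q : ℕ) (hq : 3 ≤ q) : Pmult (q + 1) = max (Pmult q) (Explicit.Tmult (q + 1)) + 1 := by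
  obtain ⟨k, rfl⟩ : ∃ k, q = k + 3 := ⟨q - 3, by omega⟩
  rfl

/-- **THEOREM P⁗ — C-025 AT EVERY LEVEL `q ≥ 3` FOR EVERY FINITE MATROID AND EVERY `p ≥ Pmult q`**, with the
threshold `Pmult` of order `q·2^{5q/4}` (induction on `q` from the `q = 3` row `SevenThree.c025_three_all` through
`c025_succ_mult`). -/
theorem c025_mult_all (q : ℕ) (hq : 3 ≤ q) :
    ∀ (M : Matroid α) [M.Finite] (p : ℕ), Pmult q ≤ p → RLS M p q := by
  induction q, hq using Nat.le_induction with
  | base =>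
    intro M _ p hp
    exact SevenThree.c025_three_all M p hp
  | succ q hq ih =>
    intro M _ p hp
    rw [Pmult_succ q hq] at hp
    refine c025_succ_mult q hq (max (Pmult q) (Explicit.Tmult (q + 1))) (le_max_right _ _) ?_ M p hp
    intro M' _ p' hP' _
    exact ih M' p' ((le_max_left _ _).trans hP')

/-- THEOREM P⁗ in the literal `C025` body at `(p, q)`. -/
theorem c025_mult_all' (q : ℕ) (hq : 3 ≤ q) (M : Matroid α) [M.Finite] (p : ℕ) (hp : Pmult q ≤ p) :
    phiK p q * ({A : Set α | A ⊆ M.E ∧ M.eRk A = (p : ℕ∞) ∧ M.eRk (M.E \ A) = (q : ℕ∞)}.ncard : ℚ) ≤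
      ({A : Set α | A ⊆ M.E ∧ (q : ℕ∞) < M.eRk A ∧ M.eRk A < (p : ℕ∞)}.ncard : ℚ) :=
  c025_mult_all q hq M p hp

/-- **THE CLOSED FORM**: `Pmult q ≤ Tmult q + 1 = q·2^{⌈5q/4⌉+2} + 5q·2^{q+2} + 1` for every `q ≥ 4`. -/
theorem Pmult_le_Tmult_succ (q : ℕ) (hq : 4 ≤ q) : Pmult q ≤ Explicit.Tmult q + 1 := by
  induction q, hq using Nat.le_induction with
  | base =>
    show max (Pmult 3) (Explicit.Tmult 4) + 1 ≤ Explicit.Tmult 4 + 1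
    have : Pmult 3 ≤ Explicit.Tmult 4 := by
      show 5 ≤ Explicit.Tmult 4
      unfold Explicit.Tmult; norm_num
    omega
  | succ q hq ih =>
    rw [Pmult_succ q (by omega)]
    have h := Explicit.Tmult_succ_le q
    have : max (Pmult q) (Explicit.Tmult (q + 1)) ≤ Explicit.Tmult (q + 1) := max_le (by omega) le_rfl
    omega

/-- **THE ROWS OF S4 (`q ≥ 7`) WITH THE MULTIPLICITY THRESHOLD**: C-025 at level `q` for every
`p ≥ q·2^{⌈5q/4⌉+2} + 5q·2^{q+2} + 1`. -/
theorem c025_mult_seven_up (q : ℕ) (hq : 7 ≤ q) (M : Matroid α) [M.Finite] (p : ℕ)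
    (hp : q * 2 ^ ((5 * q + 3) / 4 + 2) + 5 * q * 2 ^ (q + 2) + 1 ≤ p) : RLS M p q :=
  c025_mult_all q (by omega) M p ((Pmult_le_Tmult_succ q (by omega)).trans hp)

/-- Level `7` for `p ≥ 32 257` and level `8` for `p ≥ 73 729` by THEOREM P⁗ (weaker than the ladders `651` / `1 589`;
recorded for the comparison with THEOREM P‴'s `9 437 185` / `41 943 041`). -/
theorem c025_mult_seven (M : Matroid α) [M.Finite] (p : ℕ) (hp : 32257 ≤ p) : RLS M p 7 :=
  c025_mult_seven_up 7 le_rfl M p (by norm_num; omega)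

end ThmN

end PercRepro
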